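import Summits.QuantumFields.YangMills.Theorems.BalabanUVNodesN07HA1LamFree
import Literature.MathematicalPhysics.QuantumFieldTheory.Balaban1983to89.Node00.CriticalOnFibreTopGuardedB
import HarnessLib

/-!
# N07 [B11] ∕ K0⁷ road, chart side — MODULE 117′ OVER A TOP-DATA PREDICATE (S1c of the (E1)∕(iii-b) work plan, director-ym №338∕№339; FLAG №16; LOCATE-HSEAM 5d3298b8d191f169):
# ★★★★ **`hA1_lam_freeB` — `hA1_lam_free` (the (d′) letter of the head token, cell form, normalisation-free) with its DATA ROW `Sect2.DataSmall7PTop (avOfRecord F N K) s.Ω (suppDom) k δ W`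
# REPLACED by `Dat K s.Ω (suppDom) k δ W` for an arbitrary `Dat : TopData F N`** (F0c `Node00/CriticalOnFibreTopGuardedB`'s parameter) — MODULE 117′ binds the data row and never reads
# it (its (2.3)-cell rows already ARE print's datum), so the proof is 117′'s verbatim and the constants `Mh₀ R₀ C₁ τ` are the same for every `Dat`

Cell `pub-ymgap`, seat `pub-ymgap-dag-n07-e` g34 (FAN-OUT §N07 row s3; LANE OWNER of the K0 road chart side).  `--kind proof --supports stmt-QuantumFields-20541 --as helper` (K0⁷); count-neutral;
ONE theorem, no `def`.  PRINT-DATUM TWIN of `…N07HA1LamFree.hA1_lam_free` (FLAG №16 ∕ LOCATE-HSEAM 5d3298b8d191f169); the (b)-instance `hA1_lam_free` stays landed and true on its own text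
(it is the instance `Dat := dataSmall7PTopOf F N` of the theorem below, by `rfl` on the row).  No displayed premise is deleted or weakened: ONE row becomes a parameter.  MODULE 117′'s
fibre-side rows are ALREADY in [II] (2.3) currency («Λ_j = Ω_j^{(j)} ∖ Ω_{j+1}^{(j)} … for the sets of sites and the sets of bonds», p. 224; ruling (α) of record: the DIFFERENCE of the bond
sets — inward connectors belong to no `Λ_j`): `hUW` = agreement on the `LamBond` cells of `domainsOfSeq s.Ω k`, `hcc` = print's cell-form criticality there — under (E1) these are exactly
F0b's `AgreeOnB (lamDatum F K k s.Ω) (Ū U) W` ∕ `IsCritOnFibreB F N K (lamDatum F K k s.Ω) W U` unfolded (`mem_lamBondsSeq_iff_lamBond`, `isCritOnFibreB_lamBondsSeq_iff`), so no HSEAM-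
shaped premise occurs here or downstream.  [15] = [Balaban1985Variational]; [6] = [Balaban1985RegularSpaces]; [4] = [II] = [Balaban1984PropagatorsII]; [3] = [Balaban1985Averaging];
[III] = [Balaban1988Convergent]; [I] = [Balaban1987RG1].

WHY.  The S1c twins of the head (77c⁵′ ∕ 89⁵′ ∕ 122′–125′) carry the data row as a parameter `Dat` (read only by the (c′) near-row supplier, at print's `dataSmall7LamTopOf F N`); their
(d′)-Lam binder `hA1L` therefore displays `Dat K s.Ω (suppDom) k δ W`, and its supplier must be `Dat`-generic.  MODULE 117′ qualifies: its proof introduces the data row as `h7` and never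
uses it (checked; the (158) letter for `A₁` comes from the ♭ chart, the truncation rows, (T2b) and the cell-form criticality — none of which reads `W`'s plaquettes).

WHAT IS PROVED (sorry-free; no definition; axioms standard): ★★★★ `hA1_lam_freeB` (statement = 117′'s with `∀ (Dat : TopData F N)` after the constants and the data row re-spelled;
proof = 117′'s verbatim with `Dat` introduced).
HONEST LABEL (binding).  As 117′: the premises display (R4)-in-cell-form (print's criticality on the (2.3) cells — a ROW of the twin tokens at `bd := lamDatum F`, not a seam) and (T2b);
nothing of [15]∕[6]∕[4] ANALYSIS asserted beyond the cited modules; `HThm4Rec*` untouched and CONDITIONAL; K0⁷ ∕ K1⁹ NOT closed; N07 NOT discharged; counts unmoved (typed 28∕28 · discharged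
8∕28); one finite 𝕋⁴ programme at fixed ε — the route closes the conditional finite-𝕋⁴ rung `BalabanLadder.UV` ONLY; the YM mass gap (Clay) is NOT proved by any of this; nothing
continuum ∕ ℝ⁴ ∕ OS.  No `sorry`, no `def`, no `instance`, no `notation`.

References: [15] (5)–(7) p.278, (44)–(50) p.285, (55) p.286, (144) p.300, (147)–(153) p.301, (154)–(159) pp.302–303, (160)–(165) pp.303–304, Prop. 8 p.304; [6] p.98, (1.131) p.99,
(1.136) p.99; [II] (2.1)–(2.3) p.224, (2.20) p.226, (2.35) p.228, Cor. 2.8 p.249; [3] (21) p.21, Prop. 4 (134)–(135) p.38; [III] (2.10) p.256; [I] (0.1) p.251, (0.4) p.253.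
-/

set_option autoImplicit false

noncomputable section
open scoped BigOperators Matrix.Norms.L2Operator Topology
open Filter

namespace Summit.QuantumFields.YangMills.BalabanUVNodes.N07HA1LamFreeB

open Literature.MathematicalPhysics.QuantumFieldTheory.Balaban1983to89
open Literature.MathematicalPhysics.QuantumFieldTheory.Balaban1983to89.Node00
open Literature.MathematicalPhysics.QuantumFieldTheory.Balaban1983to89.B15DeterminingSets
open Literature.MathematicalPhysics.QuantumFieldTheory.Balaban1983to89.B15DeterminingSetsB
open Literature.MathematicalPhysics.QuantumFieldTheory.Balaban1983to89.B12RegularSpaces111 (gaugeU expI grad)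
open LatticeFieldCalculus (bondAvgIter)
open B15Eq112TorusCover (cover)
open B14DomainGeom (Pt Within)
open B5Eq118OneStroke (iterBlockOf)
open B8Eq131Cubes (sqLo sqHi box cube box_subset_cube)
open B6SectADomainsV1 (Domains)
open B6SectAOperatorsV1 (BondIdx RE dsE QpE QE QsE)
open B6SectAVectorModelV1 (deltaAE GE EE)
open B6SectA (hOp)
open B9AdOrthogonal (herm0)
open T4AdjointCovarianceUnitary (lieSU)
open Literature.MathematicalPhysics.QuantumFieldTheory.BalabanImbrieJaffe1984to88.BIJ85AxialPropagator411 (BondSpace)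
open T4Continuum (T4Family)
open GaugeField (gaugeAct)
open Summit.QuantumFields.YangMills.Theorems.FlatCubeOpsText (Adm22)
open Summit.QuantumFields.YangMills.Theorems.K0FlatCubeOpsTextP (flatH IsLevWeight)
open Summit.QuantumFields.YangMills.Theorems.Prop8Chart (expCfg coe_expCfg)
open Summit.QuantumFields.YangMills.BalabanUVNodes.N07HalvingStepTopOfLocalLetters (Letters10On)
open Summit.QuantumFields.YangMills.BalabanUVNodes.N07Letters10OnA1NearTopLam (exists_letters10On_A1_of_flatSocket_T4_nearTop_lam)
open Summit.QuantumFields.YangMills.BalabanUVNodes.N07DPrimeChartPreimageAtRecord (exists_chart_preimage_T4)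
open Summit.QuantumFields.YangMills.BalabanUVNodes.N07DPrimeAssemblyKit (exists_kernelMapC Letters10On.of_I_eta_smul norm_I_eta_smul truncation_gradRows_of_T2b slice_row_chart_of_eq
  letters_transfer_of_eq)
open Summit.QuantumFields.YangMills.BalabanUVNodes.N07DPrimeTruncationRows (truncation_rows_of_T2)
open Summit.QuantumFields.YangMills.BalabanUVNodes.N07DPrimeChartDictionary (hasDerivAt_zero_form_of_critLam)
open Summit.QuantumFields.YangMills.BalabanUVNodes.N07DPrimeHermitianLetter (coe_expI_eq_exp sub_HV_QV_add_HV_eq)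
open Summit.QuantumFields.YangMills.BalabanUVNodes.N07CritLamTowerClauses (critLam_meet_tower_of_critLam_seq_of_eqOn)
open Summit.QuantumFields.YangMills.BalabanUVNodes.N07ChartLogReality (I_eta_smul_mem_lieSU)
open Summit.QuantumFields.YangMills.Theorems.K0S5MeetFamilyJunction (meet_cube_domainsOfSeq_k)
open Summit.QuantumFields.YangMills.BalabanUVNodes.N07DPrimeDatumPackage (adm22_and_window_of_meetDatum mem_herm0_of_gaugeEq threshold_lt)

/-! ## ★★★★ The (d′) letter in cell form -/

open scoped Classical in
/-- ★★★★ **`hA1_lam_freeB` — THE (d′) LETTER OF THE HEAD TOKEN IN CELL FORM, NORMALISATION-FREE, OVER A TOP-DATA PREDICATE `Dat`** — print-datum twin of `hA1_lam_free` (FLAG №16 ∕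
LOCATE-HSEAM 5d3298b8d191f169); the (b)-data instance `hA1_lam_free` stays landed and true on its own text: for every `F, N` there are `Mh₀ R₀ : ℕ`, `C₁ ≥ 0`, `τ > 0` such that FOR EVERY
`Dat : TopData F N` and MODULE 100's structural letters (`M_h = L^{a′} ≥ Mh₀`, `R ≥ R₀`, `L·M_h ∣ ρ`, `R·L·M_h ≤ ρ`, `L ≤ ρ`, the guard constants `c, c₀` and their side conditions), EVERY step
guard `Adm` implying the V20-G conjuncts and the run's grid numerics, `0 < B₃`, `0 < κ`, `κ·a₀ ≤ τ`: MODULE 117′'s `hA1_lam_free` body with its data row `Sect2.DataSmall7PTop (avOfRecord F N K)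
s.Ω (suppDom) k δ W` REPLACED by `Dat K s.Ω (suppDom) k δ W` (the row is threaded, never read); the (2.3)-cell rows (`k ≤ m + K`, agreement on the cells of `domainsOfSeq s.Ω k`, print's
cell-form criticality there), (T2b) and `t₁ ε δ (K − n) := C₁·(κ·ε_{K−n})²` UNCHANGED.
[cite: Balaban1985Variational, (144) p.300, (150)–(153) p.301, (154)–(159) pp.302–303, (44)–(50) p.285, (55) p.286, (7) p.278, Prop. 8 p.304; Balaban1985RegularSpaces, (1.131) p.99, (1.136) p.99; Balaban1984PropagatorsII, (2.3) p.224, (2.20) p.226, (2.35) p.228; Balaban1985Averaging, (21) p.21; Balaban1987RG1, (0.4) p.253] -/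
theorem hA1_lam_freeB (F : T4Family) (N : ℕ) [NeZero N] :
    ∃ (Mh₀ R₀ : ℕ) (C₁ τ : ℝ), 0 ≤ C₁ ∧ 0 < τ ∧
    ∀ (Dat : TopData F N) {ρ : ℕ} {Mc Mh R a' : ℕ} (_ : Mh = F.L ^ a') (_ : Mh₀ ≤ Mh) (_ : R₀ ≤ R) (_ : F.L * Mh ∣ ρ) (_ : R * (F.L * Mh) ≤ ρ) (_ : F.L ≤ ρ)
      {c c₀ : ℕ} (_ : (11 * 4 + 4 * ρ + Mc + 3) * F.L ≤ c) (_ : Mc + 11 * 4 + 6 * ρ ≤ 2 * F.L ^ c₀) (_ : F.m ≤ c₀) (_ : a' + 3 ≤ c₀)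
      (Adm : StepGuard F) (_ : ∀ (ν : Stage7Numerics) (M : ℕ) (g : ℕ → ℝ) (K k : ℕ) (s : SeqOfRecord F ν M g K k), Adm ν M g K k s → c ≤ ν.M₁ ∧ k + c₀ ≤ F.m + K)
      (_ : ∀ (ν : Stage7Numerics) (M : ℕ) (g : ℕ → ℝ) (K k : ℕ) (s : SeqOfRecord F ν M g K k), Adm ν M g K k s → ∀ j : ℕ, 1 ≤ j → j ≤ k →
        F.L * Mh ∣ M * RkOfRecord (F.P K).L ν.r (g j) ∧ dCubeSide (F.P K).L M (RkOfRecord (F.P K).L ν.r (g j)) j ∣ (F.P K).sitesPerDir 0)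
      {B₃ κ a₀ a₁ : ℝ} (_ : 0 < B₃) (_ : 0 < κ) (_ : κ * a₀ ≤ τ),
    ∀ (ν : Stage7Numerics) (M : ℕ) (g : ℕ → ℝ) (K k : ℕ) (s : SeqOfRecord F ν M g K k), Sect2.SeqSeparated ν.M₁ s → 0 < ν.M₁ →
      Adm ν M g K k s → 1 ≤ k →
      ∀ (ε δ : ℕ → ℝ),
      (∀ n, n ≤ k → 0 < δ n ∧ δ n ≤ a₁) → (∀ n, n < k → δ n ≤ 2 * δ (n + 1)) → (∀ n, n < k → δ (n + 1) ≤ 2 * δ n) →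
      (∀ n, n ≤ k → B₃ * δ n ≤ ε n ∧ ε n ≤ a₀) → (∀ n, n < k → ε n ≤ 2 * ε (n + 1)) → (∀ n, n < k → ε (n + 1) ≤ 2 * ε n) →
      ∀ W : MSField (F.P K) (SU N), Dat K s.Ω (suppDomOfRecord F ν K s.Ω) k δ W →
      ∀ U : GaugeField (F.P K) 0 (SU N),
      (∀ n, n ≤ k → PlaqSmallOn (Sect2.omegaPlaqsTop s.Ω (suppDomOfRecord F ν K s.Ω) n) (ε n * (F.P K).eta n ^ 2) U) →
      (∀ n, n ≤ k → Sect2.CoDivSmallOn (Sect2.omegaBondsTop s.Ω (suppDomOfRecord F ν K s.Ω) n) (ε n * (F.P K).eta n ^ 3) U) →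
      -- ★ (R4) THE SEAM: the data on the (2.3) CELLS of the record's family and PRINT's CELL-FORM CRITICALITY there (replaces `AgreeOn (genSet …)` ∕ `IsCritOnFibre … (genSet s.Ω k) …`)
      ∀ (hkk : k ≤ (F.P K).m + (F.P K).K),
      (∀ (j : ℕ) (c : PBond (F.P K) j), (domainsOfSeq s.Ω k hkk).LamBond j c → avgFamily (avOfRecord F N K) U j c = W j c) →
      (∀ γ : ℝ → GaugeField (F.P K) 0 (SU N), γ 0 = U →
        DifferentiableAt ℝ (fun (t : ℝ) (b : PBond (F.P K) 0) => ((γ t b : SU N) : Matrix (Fin N) (Fin N) ℂ)) 0 →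
          (∀ᶠ t in 𝓝 (0 : ℝ), ∀ (j : ℕ) (c : PBond (F.P K) j), (domainsOfSeq s.Ω k hkk).LamBond j c →
            avgFamily (avOfRecord F N K) (γ t) j c = W j c) →
            ∀ a : ℝ, HasDerivAt (fun t => wilsonAction4 (γ t)) a 0 → a = 0) →
      ∀ (n : ℕ) (hk : K - n ≤ (F.P K).m + (F.P K).K), 1 ≤ K - n → K - n ≤ k → ∀ (idx : Pt (F.P K).d),
      -- MEETING DATUMS ONLY
      (∃ x ∈ box (F.P K).L (cornerP (F.P K) Mc ρ idx) (sideP (F.P K) Mc ρ) (K - n), ∃ y : Pt (F.P K).d, cover (F.P K) y ∈ s.Ω (K - n) ∧ Within ((3 : ℕ) : ℤ) x y) →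
      -- PRINT-MARGIN-CLEAN DATUMS ONLY
      (K - n = k ∨ ∀ z ∈ box (F.P K).L (cornerP (F.P K) Mc ρ idx - ((2 * ρ : ℕ) : Pt (F.P K).d)) (sideP (F.P K) Mc ρ + 2 * (2 * ρ)) (K - n),
        cover (F.P K) z ∉ s.Ω (K - n + 1)) →
      -- THE FAMILY: print's (150)
      ∀ {HVd : Domains (F.P K)}
        (_ : HVd = domainsMeet (cubeDomains (F.P K) (cornerP (F.P K) Mc ρ idx) (sideP (F.P K) Mc ρ) ρ (K - n) hk) (domainsOfSeq s.Ω (K - n) hk))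
        (lo hi : ℕ → Pt (F.P K).d),
      lo 0 = (fun i => ((F.P K).L : ℤ) * (sqLo (F.P K).L (cornerP (F.P K) Mc ρ idx) ρ (K - n) 1 i - 1)) →
      hi 0 = (fun i => ((F.P K).L : ℤ) * (sqHi (F.P K).L (cornerP (F.P K) Mc ρ idx) (sideP (F.P K) Mc ρ) ρ (K - n) 1 i + 1) + (((F.P K).L : ℤ) - 1)) →
      (∀ j', 1 ≤ j' → lo j' = sqLo (F.P K).L (cornerP (F.P K) Mc ρ idx) ρ (K - n) j' - 1) →
      (∀ j', 1 ≤ j' → hi j' = sqHi (F.P K).L (cornerP (F.P K) Mc ρ idx) (sideP (F.P K) Mc ρ) ρ (K - n) j' + 1) →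
      ∀ (HV : (BondIdx HVd → MatA N) →ₗ[ℂ] (PBond (F.P K) 0 → MatA N)),
        (∀ (Bf : BondIdx HVd → MatA N) (b : PBond (F.P K) 0), HV Bf b = ∑ c, ((flatH (F.P K) (K - n) HVd (Pi.single c 1) b : ℝ) : ℂ) • Bf c) →
      ∀ (u : GaugeTransf (F.P K) 0 (SU N)) (A : PBond (F.P K) 0 → MatA N),
      (∀ b ∈ (Sect2.regionOfSet (F.P K) (cover (F.P K) '' box (F.P K).L (cornerP (F.P K) Mc ρ idx) (sideP (F.P K) Mc ρ) (K - n))).bonds,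
        gaugeU (fun x => ιSU N (u x)) (fun b' => ιSU N (U b')) b = expI ((F.P K).eta (K - n)) (A b)) →
      -- (T1) the gauge equation on the WHOLE TOWER `□₀`
      (∀ b ∈ (Sect2.regionOfSet (F.P K) (cover (F.P K) '' cube (F.P K).L (cornerP (F.P K) Mc ρ idx) (sideP (F.P K) Mc ρ) ρ (K - n) 0)).bonds,
        gaugeU (fun x => ιSU N (u x)) (fun b' => ιSU N (U b')) b = expI ((F.P K).eta (K - n)) (A b)) →
      -- (T2) (152)'s first member, level-weighted, on every `□_{j′}`, `j′ ≤ K − n`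
      (∀ j', j' ≤ K - n →
        ∀ b ∈ (Sect2.regionOfSet (F.P K) (cover (F.P K) '' cube (F.P K).L (cornerP (F.P K) Mc ρ idx) (sideP (F.P K) Mc ρ) ρ (K - n) j')).bonds,
          ‖A b‖ < κ * ε (K - n) * ((F.P K).L : ℝ) ^ (K - n - j')) →
      -- ★ (T2b) (152)'s SECOND member, level-weighted, on every `□_{j′}`, `j′ ≤ K − n` (the located conjunct of ⚑ LOCATED-DPRIME-T2-GRADIENT)
      (∀ j', j' ≤ K - n →
        ∀ q ∈ (Sect2.regionOfSet (F.P K) (cover (F.P K) '' cube (F.P K).L (cornerP (F.P K) Mc ρ idx) (sideP (F.P K) Mc ρ) ρ (K - n) j')).dpairs,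
          ‖grad ((F.P K).eta (K - n)) q.2.1 (fun y => A ⟨y, q.2.2⟩) q.1‖ < κ * ε (K - n) * ((F.P K).L : ℝ) ^ (2 * (K - n - j'))) →
      (∀ b ∈ (Sect2.regionOfSet (F.P K) (cover (F.P K) '' box (F.P K).L (cornerP (F.P K) Mc ρ idx) (sideP (F.P K) Mc ρ) (K - n))).bonds,
        ‖A b‖ < κ * ε (K - n)) →
      (∀ q ∈ (Sect2.regionOfSet (F.P K) (cover (F.P K) '' box (F.P K).L (cornerP (F.P K) Mc ρ idx) (sideP (F.P K) Mc ρ) (K - n))).dpairs,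
        ‖grad ((F.P K).eta (K - n)) q.2.1 (fun y => A ⟨y, q.2.2⟩) q.1‖ < κ * ε (K - n)) →
      (∀ b ∈ Sect2.bondsDeep (cover (F.P K) '' box (F.P K).L (cornerP (F.P K) Mc ρ idx) (sideP (F.P K) Mc ρ) (K - n)),
        ‖Sect2.codiffCurlA ((F.P K).eta (K - n)) A b.src b.dir‖ < κ * ε (K - n)) →
      (∀ b ∈ Sect2.bondsDeep (cover (F.P K) '' box (F.P K).L (cornerP (F.P K) Mc ρ idx) (sideP (F.P K) Mc ρ) (K - n)),
        ‖∑ ν' : Fin (F.P K).d, (((F.P K).eta (K - n) : ℝ) : ℂ)⁻¹ •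
            (grad ((F.P K).eta (K - n)) ν' (fun y => A ⟨y, b.dir⟩) (b.src.unshift ν') - grad ((F.P K).eta (K - n)) ν' (fun y => A ⟨y, b.dir⟩) b.src)‖ <
          κ * ε (K - n)) →
      (∀ D' : Domains (F.P K), LinearMap.ker (QpE D') ≤ LinearMap.ker (QpE HVd) → ∀ φ : MatA N →L[ℂ] ℂ,
        RE D' ((F.P K).eta (K - n))⁻¹ (dsE ((F.P K).eta (K - n))⁻¹ (WithLp.toLp 2 fun b => (φ (A b)).re : BondSpace (F.P K))) = 0 ∧
        RE D' ((F.P K).eta (K - n))⁻¹ (dsE ((F.P K).eta (K - n))⁻¹ (WithLp.toLp 2 fun b => (φ (A b)).im : BondSpace (F.P K))) = 0) →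
      Letters10On (cover (F.P K) '' box (F.P K).L (cornerP (F.P K) Mc ρ idx) (sideP (F.P K) Mc ρ) (K - n)) ((F.P K).eta (K - n)) (C₁ * (κ * ε (K - n)) ^ 2)
        (fun b => A b - HV (fun c : BondIdx HVd =>
          if (∀ x : Site (F.P K) 0, (iterBlockOf (c.1.1 : ℕ) x = c.1.2.src ∨ iterBlockOf (c.1.1 : ℕ) x = c.1.2.tgt) →
              x ∈ cover (F.P K) '' cube (F.P K).L (cornerP (F.P K) Mc ρ idx) (sideP (F.P K) Mc ρ) ρ (K - n) 0)
          then bondAvgIter (c.1.1 : ℕ) A c.1.2 else 0) b) := by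
  classical
  -- ── the suppliers' constants: S4-Lam (MODULE 114) and the chart preimage (MODULE 116)
  obtain ⟨Mh₁, R₁, B₀, δ₀, B₃', CG, εS, C₄, hδ₀, hB₃', hCG, hεS, hC₄, hS⟩ := exists_letters10On_A1_of_flatSocket_T4_nearTop_lam (N := N) F
  obtain ⟨Mh₂, R₂, Bq, hBq, hpreAll⟩ := exists_chart_preimage_T4 N F
  obtain ⟨r₀, hr₀, hpre⟩ := hpreAll εS C₄ hεS hC₄
  have hL1 : (1 : ℝ) ≤ F.L := by exact_mod_cast F.hL.2.le
  have hLn0 : 0 < F.L := by have := F.hL11; omega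
  -- the threshold factor and the letter `C₁`, the smallness `τ`
  obtain ⟨Mx, hMx⟩ : ∃ Mx : ℝ, Mx = max 0 (max B₀ (1 + (B₀ * B₃' + 1) * (F.L : ℝ) * CG)) := ⟨_, rfl⟩
  have hMx0 : 0 ≤ Mx := by rw [hMx]; exact le_max_left _ _
  have hMxB : max B₀ (1 + (B₀ * B₃' + 1) * (F.L : ℝ) * CG) ≤ Mx := by rw [hMx]; exact le_max_right _ _
  obtain ⟨T, hT⟩ : ∃ T : ℝ, T = (F.L : ℝ) ^ 8 * Mx * (2 * C₄) + 1 := ⟨_, rfl⟩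
  have hT0 : 0 < T := by rw [hT]; positivity
  obtain ⟨C₁, hC₁⟩ : ∃ C₁ : ℝ, C₁ = T * ((F.L : ℝ) ^ 2 * (1 + Bq * r₀)) ^ 2 := ⟨_, rfl⟩
  obtain ⟨τ, hτ⟩ : ∃ τ : ℝ, τ = min (r₀ / (F.L : ℝ) ^ 2) (rhoSU N / 2) := ⟨_, rfl⟩
  have hρSU := rhoSU_pos (N := N)
  have hτ0 : 0 < τ := by rw [hτ]; exact lt_min (by positivity) (by positivity)
  have hτ1 : τ * (F.L : ℝ) ^ 2 ≤ r₀ := by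
    have h := min_le_left (r₀ / (F.L : ℝ) ^ 2) (rhoSU N / 2)
    rw [← hτ] at h
    have := mul_le_mul_of_nonneg_right h (by positivity : (0 : ℝ) ≤ (F.L : ℝ) ^ 2)
    rwa [div_mul_cancel₀ _ (by positivity)] at this
  have hτ2 : τ ≤ rhoSU N / 2 := by rw [hτ]; exact min_le_right _ _
  refine ⟨max Mh₁ Mh₂, max (max R₁ R₂) 3, C₁, τ, by rw [hC₁]; positivity, hτ0, ?_⟩
  intro Dat ρ Mc Mh R a' hMha hMh hR hdvd hRρ hLρ c c₀ hc hc₀ hmc₀ hac₀ Adm hAdm₁ hAdm₂ B₃ κ a₀ a₁ hB₃ hκ hκa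
    ν M g K k s hsep hM₁ hadm hk ε δ hδ hcompδ hcompδ' hε hεcomp hεcomp' W h7 U h17 h19 hkk hUW hcritU n hk hk1 hjk idx hmeet hclean HVd hHVd
    lo hi hlo0 hhi0 hloj hhij HV hHV u A he heT hAT hAT2 hA hdA hcd hlap h153
  -- ── the structural letters at this datum
  have hMh₁ : Mh₁ ≤ Mh := (le_max_left _ _).trans hMh
  have hMh₂ : Mh₂ ≤ Mh := (le_max_right _ _).trans hMh
  have hR₁ : R₁ ≤ R := ((le_max_left _ _).trans (le_max_left _ _)).trans hR
  have hR₂ : R₂ ≤ R := ((le_max_right _ _).trans (le_max_left _ _)).trans hR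
  have hR3 : 3 ≤ R := (le_max_right _ _).trans hR
  have hV20 : c ≤ ν.M₁ ∧ k + c₀ ≤ F.m + K := hAdm₁ ν M g K k s hadm
  have hmK : (F.P K).m + (F.P K).K = F.m + K := rfl
  have hk' : K - n + 1 ≤ F.m + K := by omega
  have hsize : a' + 3 ≤ F.m + n := by omega
  have hMhpos : 0 < Mh := by rw [hMha]; exact pow_pos hLn0 a'
  have hρ3 : 3 * (F.P K).L ≤ ρ := by
    have h1 : 3 * (F.L * Mh) ≤ R * (F.L * Mh) := Nat.mul_le_mul_right _ hR3
    have h2 : F.L ≤ F.L * Mh := Nat.le_mul_of_pos_right _ hMhpos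
    show 3 * F.L ≤ ρ; omega
  have hρ2 : 2 ≤ ρ := by have := F.hL11; have : F.L ≤ ρ := hLρ; omega
  -- the datum package: `Adm22 D″ R (L·M_h)` and the window over `Ω′_{K−n−1}` (MODULE 116b); the family's letters
  obtain ⟨hAdmD', hY'⟩ := adm22_and_window_of_meetDatum F ν M g K k s hsep hM₁ hMha hdvd hRρ hLρ hc hc₀ (by omega) hV20.1 hV20.2 (hAdm₂ ν M g K k s hadm)
    hk hk1 hjk idx hmeet
  have hDk : HVd.k = K - n := by rw [hHVd]; exact meet_cube_domainsOfSeq_k (P := F.P K) s.Ω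
  have hAdmD : Adm22 HVd R (F.L * Mh) := by rw [hHVd]; exact hAdmD'
  have hY : ∀ x ∈ cover (F.P K) '' box (F.P K).L (cornerP (F.P K) Mc ρ idx) (sideP (F.P K) Mc ρ) (K - n), HVd.InOm (K - n - 1) x := by rw [hHVd]; exact hY'
  obtain ⟨w, hw⟩ : ∃ w : ℕ → PBond (F.P K) 0 → ℝ, IsLevWeight (F.P K) (K - n) HVd w := ⟨_, fun _ _ => rfl⟩
  have hw' : IsLevWeight (F.P K) (K - n)
      (domainsMeet (cubeDomains (F.P K) (cornerP (F.P K) Mc ρ idx) (sideP (F.P K) Mc ρ) ρ (K - n) hk) (domainsOfSeq s.Ω (K - n) hk)) w := hHVd ▸ hw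
  have hw1pos : ∀ b, 0 < w 1 b := fun b => by rw [hw 1 b, pow_one]; positivity
  have hw2nn : ∀ b, 0 ≤ w 2 b := fun b => by rw [hw 2 b]; positivity
  -- ── S4-Lam's ♭ chart at `D″`
  obtain ⟨H, Dsel, hH, h55, hcd, hfix, hherm, hmain⟩ := hS n K hk1 hk' hMha hMh₁ hR₁ hsize HVd hDk hAdmD w hw
  -- ── the letters `η`, `κε`
  set η : ℝ := ((((F.P K).L : ℝ))⁻¹) ^ (K - n) with hηdef
  have hηeta : (F.P K).eta (K - n) = η := rfl
  have hη0 : 0 < η := by rw [hηdef]; positivity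
  have hηne : η ≠ 0 := hη0.ne'
  have hηL : η * ((F.P K).L : ℝ) ^ (K - n) = 1 := by
    rw [hηdef, inv_pow, inv_mul_cancel₀ (pow_ne_zero _ (by positivity))]
  have hηinv : η⁻¹ = ((F.P K).L : ℝ) ^ (K - n) := by rw [hηdef, inv_pow, inv_inv]
  obtain ⟨κε, hκε⟩ : ∃ κε : ℝ, κε = κ * ε (K - n) := ⟨_, rfl⟩
  have hεpos : 0 < ε (K - n) := lt_of_lt_of_le (mul_pos hB₃ (hδ _ hjk).1) (hε _ hjk).1
  have hκε0 : 0 < κε := by rw [hκε]; exact mul_pos hκ hεpos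
  have hκετ : κε ≤ τ := by rw [hκε]; exact (mul_le_mul_of_nonneg_left (hε _ hjk).2 hκ.le).trans hκa
  have hκε1 : κε ≤ 1 := by linarith only [hκετ, hτ2, rhoSU_le_third (N := N)]
  -- ── the truncation `Ã = 𝟙_{π″□₀}·A`, its global rows and its reality
  obtain ⟨At, hAt⟩ : ∃ At : PBond (F.P K) 0 → MatA N, ∀ b, At b =
      if b ∈ (Sect2.regionOfSet (F.P K) (cover (F.P K) '' cube (F.P K).L (cornerP (F.P K) Mc ρ idx) (sideP (F.P K) Mc ρ) ρ (K - n) 0)).bonds then A b else 0 :=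
    ⟨fun b => if b ∈ (Sect2.regionOfSet (F.P K) (cover (F.P K) '' cube (F.P K).L (cornerP (F.P K) Mc ρ idx) (sideP (F.P K) Mc ρ) ρ (K - n) 0)).bonds then A b else 0,
      fun _ => rfl⟩
  have hin : ∀ b ∈ (Sect2.regionOfSet (F.P K) (cover (F.P K) '' cube (F.P K).L (cornerP (F.P K) Mc ρ idx) (sideP (F.P K) Mc ρ) ρ (K - n) 0)).bonds, At b = A b :=
    fun b hb => by rw [hAt b, if_pos hb]
  have hout : ∀ b ∉ (Sect2.regionOfSet (F.P K) (cover (F.P K) '' cube (F.P K).L (cornerP (F.P K) Mc ρ idx) (sideP (F.P K) Mc ρ) ρ (K - n) 0)).bonds, At b = 0 :=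
    fun b hb => by rw [hAt b, if_neg hb]
  have hT2' : ∀ j', j' ≤ K - n → ∀ b ∈ (Sect2.regionOfSet (F.P K) (cover (F.P K) '' cube (F.P K).L (cornerP (F.P K) Mc ρ idx) (sideP (F.P K) Mc ρ) ρ (K - n) j')).bonds,
      ‖A b‖ < κε * ((F.P K).L : ℝ) ^ (K - n - j') := fun j' hj' b hb => by rw [hκε]; exact hAT j' hj' b hb
  have hT20 : ∀ b ∈ (Sect2.regionOfSet (F.P K) (cover (F.P K) '' cube (F.P K).L (cornerP (F.P K) Mc ρ idx) (sideP (F.P K) Mc ρ) ρ (K - n) 0)).bonds,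
      ‖A b‖ < κε * ((F.P K).L : ℝ) ^ (K - n) := fun b hb => by have := hT2' 0 (Nat.zero_le _) b hb; rwa [Nat.sub_zero] at this
  have hT2b' : ∀ j', j' ≤ K - n → ∀ q ∈ (Sect2.regionOfSet (F.P K) (cover (F.P K) '' cube (F.P K).L (cornerP (F.P K) Mc ρ idx) (sideP (F.P K) Mc ρ) ρ (K - n) j')).dpairs,
      ‖grad ((F.P K).eta (K - n)) q.2.1 (fun y => A ⟨y, q.2.2⟩) q.1‖ < κε * ((F.P K).L : ℝ) ^ (2 * (K - n - j')) := fun j' hj' q hq => by rw [hκε]; exact hAT2 j' hj' q hq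
  obtain ⟨hAt1, -⟩ := truncation_rows_of_T2 (domainsOfSeq s.Ω (K - n) hk) hρ2 hw' (V := MatA N) hκε0.le hT2' hin hout
  have hAt2 := truncation_gradRows_of_T2b (N := N) (domainsOfSeq s.Ω (K - n) hk) hρ2 hw' hκε0.le hT20 hT2b' hin hout
  -- `Ã` is Hermitian-traceless: on `R₀`, `iηA(b) = log U^u(b) ∈ 𝔰𝔲(N)` (MODULE 116b §2 ∕ 108 §1); elsewhere `0`
  have hIη : (Complex.I * (η : ℂ)) ≠ 0 := mul_ne_zero Complex.I_ne_zero (Complex.ofReal_ne_zero.2 hηne)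
  have h2κε : 2 * κε ≤ rhoSU N := by linarith only [hκετ, hτ2]
  have hAth : ∀ b, At b ∈ herm0 (Fin N) := by
    intro b
    by_cases hb : b ∈ (Sect2.regionOfSet (F.P K) (cover (F.P K) '' cube (F.P K).L (cornerP (F.P K) Mc ρ idx) (sideP (F.P K) Mc ρ) ρ (K - n) 0)).bonds
    · rw [hin b hb]
      refine mem_herm0_of_gaugeEq hη0 h2κε u U A (heT b hb) ?_
      have := mul_le_mul_of_nonneg_left (hT20 b hb).le hη0.le
      rwa [← mul_assoc, mul_comm η κε, mul_assoc, hηL, mul_one] at this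
    · rw [hout b hb]; exact (herm0 (Fin N)).zero_mem
  -- ── the chart preimage `A′ = Ã + H Z` (MODULE 116) at radius `r := κε·L²`
  obtain ⟨r, hr⟩ : ∃ r : ℝ, r = κε * ((F.P K).L : ℝ) ^ 2 := ⟨_, rfl⟩
  have hr0 : 0 < r := by rw [hr]; positivity
  have hrr₀ : r ≤ r₀ := by rw [hr]; exact (mul_le_mul_of_nonneg_right hκετ (by positivity)).trans hτ1
  have hLL2 : ((F.P K).L : ℝ) ≤ ((F.P K).L : ℝ) ^ 2 := by
    show (F.L : ℝ) ≤ (F.L : ℝ) ^ 2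
    nlinarith only [hL1]
  have hAt1' : ∀ b, w 1 b * ‖At b‖ ≤ r := fun b => (hAt1 b).trans (by rw [hr]; exact mul_le_mul_of_nonneg_left hLL2 hκε0.le)
  have hAt2' : ∀ (b : PBond (F.P K) 0) (ν' : Fin (F.P K).d), w 2 b * ((F.P K).L : ℝ) ^ (K - n) * ‖At ⟨b.src.shift ν', b.dir⟩ - At b‖ ≤ r :=
    fun b ν' => (hAt2 b ν').trans (le_of_eq hr.symm)
  obtain ⟨Z, hA'1, hA'2, hr'ε, hball, hpre', hA'h⟩ :=
    hpre n K hk1 hk' hMha hMh₂ hR₂ hsize HVd hDk hAdmD w hw H hH Dsel h55 hfix At r hr0.le hrr₀ hAt1' hAt2' hAth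
  -- ── the chart parameter `X := iη·A′` in `𝔰𝔲(N)`, its size ∕ gradient ∕ slice rows
  obtain ⟨X, hX⟩ : ∃ X : PBond (F.P K) 0 → lieSU (Fin N), ∀ b, ((X b : lieSU (Fin N)) : MatA N) = (Complex.I * (η : ℂ)) • (At + H Z) b :=
    ⟨fun b => ⟨(Complex.I * (η : ℂ)) • (At + H Z) b, I_eta_smul_mem_lieSU η (hA'h b)⟩, fun _ => rfl⟩
  obtain ⟨ρ', hρ'⟩ : ∃ ρ' : ℝ, ρ' = η * (r + Bq * r ^ 2) := ⟨_, rfl⟩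
  have hr'0 : 0 < r + Bq * r ^ 2 := by positivity
  have hρ'lt : ρ' < η * εS := by rw [hρ']; exact mul_lt_mul_of_pos_left hr'ε hη0
  have hX1 : ∀ b, w 1 b * ‖((X b : lieSU (Fin N)) : MatA N)‖ ≤ ρ' := fun b => by
    rw [hX b, norm_I_eta_smul hη0.le, hρ', mul_left_comm]
    exact mul_le_mul_of_nonneg_left (hA'1 b) hη0.le
  have hX2 : ∀ (b : PBond (F.P K) 0) (ν' : Fin 4),
      w 2 b * (F.L : ℝ) ^ (K - n) * ‖((X ⟨b.src.shift ν', b.dir⟩ : lieSU (Fin N)) : MatA N) - ((X b : lieSU (Fin N)) : MatA N)‖ ≤ ρ' := fun b ν' => by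
    rw [hX, hX, ← smul_sub, norm_I_eta_smul hη0.le, hρ']
    have h := mul_le_mul_of_nonneg_left (hA'2 b ν') hη0.le
    calc w 2 b * (F.L : ℝ) ^ (K - n) * (η * ‖(At + H Z) ⟨b.src.shift ν', b.dir⟩ - (At + H Z) b‖)
        = η * (w 2 b * ((F.P K).L : ℝ) ^ (K - n) * ‖(At + H Z) ⟨b.src.shift ν', b.dir⟩ - (At + H Z) b‖) := by
          show w 2 b * (F.L : ℝ) ^ (K - n) * (η * _) = η * (w 2 b * (F.L : ℝ) ^ (K - n) * _); ring
      _ ≤ η * (r + Bq * r ^ 2) := h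
  have h153D : ∀ φ : MatA N →L[ℂ] ℂ,
      RE HVd (((F.P K).L : ℝ) ^ (K - n)) (dsE (((F.P K).L : ℝ) ^ (K - n)) (WithLp.toLp 2 fun b => (φ (A b)).re : BondSpace (F.P K))) = 0 ∧
      RE HVd (((F.P K).L : ℝ) ^ (K - n)) (dsE (((F.P K).L : ℝ) ^ (K - n)) (WithLp.toLp 2 fun b => (φ (A b)).im : BondSpace (F.P K))) = 0 := by
    intro φ
    have h := h153 HVd le_rfl φ
    rwa [hηeta, hηinv] at h
  have hslice : ∀ φ : Matrix (Fin N) (Fin N) ℂ →L[ℂ] ℂ,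
      RE HVd (((F.P K).L : ℝ) ^ (K - n)) (dsE (((F.P K).L : ℝ) ^ (K - n))
        (WithLp.toLp 2 (fun b => (φ ((X b : lieSU (Fin N)) : Matrix (Fin N) (Fin N) ℂ)).re))) = 0 := by
    intro φ
    have h := slice_row_chart_of_eq (N := N) (domainsOfSeq s.Ω (K - n) hk) hHVd hk1 hρ2
      (fun t : BondIdx HVd => (((F.P K).L : ℝ) ^ (t.1.1 : ℕ) * ((((F.P K).L : ℝ))⁻¹) ^ (K - n))⁻¹) H hH A At hin Z η h153D φ
    have hfun : (fun b => (φ ((X b : lieSU (Fin N)) : Matrix (Fin N) (Fin N) ℂ)).re) = fun b => (φ ((Complex.I * (η : ℂ)) • (At + H Z) b)).re := by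
      funext b; rw [hX b]
    rw [hfun]; exact h
  -- ── the globally read configuration `U₁ := U^u` on `R₀`, `1` elsewhere; it READS the charted point `A′` and is print-critical on `D″`
  obtain ⟨U₁, hU₁def⟩ : ∃ U₁ : GaugeField (F.P K) 0 (SU N), ∀ b, U₁ b =
      if b ∈ (Sect2.regionOfSet (F.P K) (cover (F.P K) '' cube (F.P K).L (cornerP (F.P K) Mc ρ idx) (sideP (F.P K) Mc ρ) ρ (K - n) 0)).bonds then gaugeAct u U b else 1 :=
    ⟨fun b => if b ∈ (Sect2.regionOfSet (F.P K) (cover (F.P K) '' cube (F.P K).L (cornerP (F.P K) Mc ρ idx) (sideP (F.P K) Mc ρ) ρ (K - n) 0)).bonds then gaugeAct u U b else 1,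
      fun _ => rfl⟩
  have hagree : ∀ b ∈ (Sect2.regionOfSet (F.P K) (cover (F.P K) '' cube (F.P K).L (cornerP (F.P K) Mc ρ idx) (sideP (F.P K) Mc ρ) ρ (K - n) 0)).bonds,
      U₁ b = gaugeAct u U b := fun b hb => by rw [hU₁def b, if_pos hb]
  have hA₁' : (fun b => (Complex.I * (((((F.P K).L : ℝ)⁻¹) ^ (K - n) : ℝ) : ℂ))⁻¹ • ((X b : lieSU (Fin N)) : Matrix (Fin N) (Fin N) ℂ)) = At + H Z := by
    funext b
    rw [hX b, ← hηdef, smul_smul, inv_mul_cancel₀ hIη, one_smul]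
  have hU₁ : ∀ b, ((U₁ b : SU N) : Matrix (Fin N) (Fin N) ℂ) =
      ((expCfg ((((F.P K).L : ℝ)⁻¹) ^ (K - n))
        ((fun b => (Complex.I * (((((F.P K).L : ℝ)⁻¹) ^ (K - n) : ℝ) : ℂ))⁻¹ • ((X b : lieSU (Fin N)) : Matrix (Fin N) (Fin N) ℂ)) -
          H (Dsel (fun b => (Complex.I * (((((F.P K).L : ℝ)⁻¹) ^ (K - n) : ℝ) : ℂ))⁻¹ • ((X b : lieSU (Fin N)) : Matrix (Fin N) (Fin N) ℂ)))) b :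
        (Matrix (Fin N) (Fin N) ℂ)ˣ) : _) := by
    intro b
    rw [hA₁', hpre', coe_expCfg, ← hηdef, hU₁def b]
    by_cases hb : b ∈ (Sect2.regionOfSet (F.P K) (cover (F.P K) '' cube (F.P K).L (cornerP (F.P K) Mc ρ idx) (sideP (F.P K) Mc ρ) ρ (K - n) 0)).bonds
    · rw [if_pos hb, hin b hb, ← coe_ιSU N, ιSU_gaugeAct, heT b hb, coe_expI_eq_exp, hηeta]
    · rw [if_neg hb, hout b hb, smul_zero, NormedSpace.exp_zero]
      rfl
  have hcrit₁ : ∀ γ : ℝ → GaugeField (F.P K) 0 (SU N), γ 0 = U₁ →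
      DifferentiableAt ℝ (fun (t : ℝ) (b : PBond (F.P K) 0) => ((γ t b : SU N) : Matrix (Fin N) (Fin N) ℂ)) 0 →
      (∀ (t : ℝ) (j : ℕ) (c : PBond (F.P K) j), j ≤ K - n → HVd.LamBond j c →
        avgFamily (avOfRecord F N K) (γ t) j c = avgFamily (avOfRecord F N K) U₁ j c) →
      HasDerivAt (fun t => wilsonAction4 (γ t)) 0 0 := by
    have h104 := critLam_meet_tower_of_critLam_seq_of_eqOn (F := F) (N := N) s.Ω hk1 hjk hk hkk (cornerP (F.P K) Mc ρ idx) (sideP (F.P K) Mc ρ) ρ hρ3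
      u hagree hUW hcritU
    rw [← hHVd] at h104
    exact hasDerivAt_zero_form_of_critLam HVd (fun j => j ≤ K - n) h104 (fun j c hc => by have := HVd.le_of_lamBond hc; rwa [hDk] at this)
  -- ── the kernel-formula letters `DV GV QV MV` (inhabited) and the supplier's form of `H_V`
  obtain ⟨DV, hDV⟩ := exists_kernelMapC (V := Matrix (Fin N) (Fin N) ℂ)
    (fun (j b : PBond (F.P K) 0) => WithLp.ofLp (deltaAE HVd ((F.P K).L ^ (K - n) : ℝ) (fun _ => (1 : ℝ)) (WithLp.toLp 2 (Pi.single j 1))) b)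
  obtain ⟨GV, hGV⟩ := exists_kernelMapC (V := Matrix (Fin N) (Fin N) ℂ)
    (fun (j b : PBond (F.P K) 0) => WithLp.ofLp ((GE HVd (c := ((F.P K).L : ℝ) ^ (K - n)) (pow_ne_zero _ (Nat.cast_ne_zero.2 (F.P K).L_pos.ne')) (w := fun _ => (1 : ℝ)) (fun _ => one_pos)
        - hOp (GE HVd (c := ((F.P K).L : ℝ) ^ (K - n)) (pow_ne_zero _ (Nat.cast_ne_zero.2 (F.P K).L_pos.ne')) (w := fun _ => (1 : ℝ)) (fun _ => one_pos)) (QsE HVd)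
            (EE HVd (c := ((F.P K).L : ℝ) ^ (K - n)) (pow_ne_zero _ (Nat.cast_ne_zero.2 (F.P K).L_pos.ne')) (w := fun _ => (1 : ℝ)) (fun _ => one_pos))
          ∘ₗ QE HVd ∘ₗ GE HVd (c := ((F.P K).L : ℝ) ^ (K - n)) (pow_ne_zero _ (Nat.cast_ne_zero.2 (F.P K).L_pos.ne')) (w := fun _ => (1 : ℝ)) (fun _ => one_pos))
        (WithLp.toLp 2 (Pi.single j 1))) b)
  obtain ⟨QV, hQV⟩ := exists_kernelMapC (V := Matrix (Fin N) (Fin N) ℂ)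
    (fun (j : PBond (F.P K) 0) (t : BondIdx HVd) => WithLp.ofLp (QE HVd (WithLp.toLp 2 (Pi.single j 1))) t)
  obtain ⟨MV, hMV⟩ := exists_kernelMapC (V := Matrix (Fin N) (Fin N) ℂ)
    (fun (j b : PBond (F.P K) 0) => WithLp.ofLp ((QsE HVd
          ∘ₗ EE HVd (c := ((F.P K).L : ℝ) ^ (K - n)) (pow_ne_zero _ (Nat.cast_ne_zero.2 (F.P K).L_pos.ne')) (w := fun _ => (1 : ℝ)) (fun _ => one_pos)
          ∘ₗ QE HVd ∘ₗ GE HVd (c := ((F.P K).L : ℝ) ^ (K - n)) (pow_ne_zero _ (Nat.cast_ne_zero.2 (F.P K).L_pos.ne')) (w := fun _ => (1 : ℝ)) (fun _ => one_pos))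
        (WithLp.toLp 2 (Pi.single j 1))) b)
  have hHV' : ∀ (B : BondIdx HVd → Matrix (Fin N) (Fin N) ℂ) (b : PBond (F.P K) 0),
      HV B b = ∑ t, ((WithLp.ofLp (hOp (GE HVd (c := ((F.P K).L : ℝ) ^ (K - n)) (pow_ne_zero _ (Nat.cast_ne_zero.2 (F.P K).L_pos.ne')) (w := fun _ => (1 : ℝ)) (fun _ => one_pos))
        (QsE HVd) (EE HVd (c := ((F.P K).L : ℝ) ^ (K - n)) (pow_ne_zero _ (Nat.cast_ne_zero.2 (F.P K).L_pos.ne')) (w := fun _ => (1 : ℝ)) (fun _ => one_pos))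
        (WithLp.toLp 2 (Pi.single t 1))) b : ℝ) : ℂ) • B t := fun B b => hHV B b
  -- ── the threshold (MODULE 116b §3)
  obtain ⟨t, htdef⟩ : ∃ t : ℝ, t = η * (T * (r + Bq * r ^ 2) ^ 2) := ⟨_, rfl⟩
  have ht : (F.L : ℝ) ^ 8 * (max B₀ (1 + (B₀ * B₃' + 1) * (F.L : ℝ) * CG) *
      ((2 * (((F.P K).L ^ (K - n) : ℝ) ^ 2 * ((((F.P K).L : ℝ)⁻¹) ^ (K - n)) ^ (F.P K).d * ((((F.P K).L : ℝ)⁻¹) ^ (K - n))⁻¹) *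
        ((((F.P K).L : ℝ)⁻¹) ^ (K - n))⁻¹ ^ 2 * C₄) * ρ' ^ 2)) < t := by
    have hd : (F.P K).d = 4 := rfl
    rw [hd, ← hηdef, htdef]
    exact threshold_lt hη0 (by rw [mul_comm]; exact hηL) hMxB hC₄ (by positivity) hρ' hr'0 (by rw [hT]; exact lt_add_one _)
  -- ★ THE SUPPLIER (MODULE 114)
  have h114 := hmain hDV hGV hQV hHV' hMV X ρ' hρ'lt hX1 hX2 hslice U₁ hU₁ hcrit₁ hY ht
  -- ── back to the head token's currency: un-scale by `iη`, `A′ − H_V Q_V A′ = Ã − H_V Q_V Ã`, the reach cut-off and `Q(Ã) = Q(A)` on the box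
  have hHZ : H Z = HV (fun t => (((((F.P K).L : ℝ) ^ (t.1.1 : ℕ) * ((((F.P K).L : ℝ))⁻¹) ^ (K - n))⁻¹ : ℝ) : ℂ) • Z t) := by
    funext b
    rw [hH, hHV]
    refine Finset.sum_congr rfl fun t _ => ?_
    rw [smul_smul, ← Complex.ofReal_mul, mul_comm]
  have hfun : ((fun b => ((X b : lieSU (Fin N)) : Matrix (Fin N) (Fin N) ℂ)) - HV (QV fun b => ((X b : lieSU (Fin N)) : Matrix (Fin N) (Fin N) ℂ))) =
      fun b => (Complex.I * (η : ℂ)) • (At - HV (QV At)) b := by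
    have hXf : (fun b => ((X b : lieSU (Fin N)) : Matrix (Fin N) (Fin N) ℂ)) = (Complex.I * (η : ℂ)) • (At + H Z) := by
      funext b; rw [hX b, Pi.smul_apply]
    rw [hXf, map_smul, map_smul, ← smul_sub, hHZ, sub_HV_QV_add_HV_eq (K - n) HVd QV hQV HV hHV]
    funext b; rw [Pi.smul_apply]
  rw [hfun] at h114
  have h2 := Letters10On.of_I_eta_smul hη0 h114
  have hteq : t / η = T * (r + Bq * r ^ 2) ^ 2 := by rw [htdef]; field_simp
  rw [hteq] at h2
  have h3 := letters_transfer_of_eq (N := N) (domainsOfSeq s.Ω (K - n) hk) hHVd hk1 hρ3 QV hQV HV hHV A At hin (box_subset_cube (Nat.zero_le _) |> Set.image_mono) h2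
  refine h3.of_le ?_
  -- the threshold `T·(r + B_q r²)² ≤ C₁·(κε)²`
  have hr' : r + Bq * r ^ 2 ≤ κε * ((F.L : ℝ) ^ 2 * (1 + Bq * r₀)) := by
    have e : κε * ((F.L : ℝ) ^ 2 * (1 + Bq * r₀)) = r + Bq * r₀ * r := by rw [hr]; show κε * ((F.L : ℝ) ^ 2 * (1 + Bq * r₀)) = κε * (F.L : ℝ) ^ 2 + Bq * r₀ * (κε * (F.L : ℝ) ^ 2); ring
    rw [e]
    have : Bq * r ^ 2 ≤ Bq * r₀ * r := by
      rw [show Bq * r ^ 2 = Bq * r * r by ring, show Bq * r₀ * r = Bq * r₀ * r by rfl]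
      exact mul_le_mul_of_nonneg_right (mul_le_mul_of_nonneg_left hrr₀ hBq) hr0.le
    linarith only [this]
  rw [hC₁, hκε] at *
  have hsq : (r + Bq * r ^ 2) ^ 2 ≤ (κ * ε (K - n) * ((F.L : ℝ) ^ 2 * (1 + Bq * r₀))) ^ 2 := pow_le_pow_left₀ hr'0.le hr' 2
  calc T * (r + Bq * r ^ 2) ^ 2 ≤ T * (κ * ε (K - n) * ((F.L : ℝ) ^ 2 * (1 + Bq * r₀))) ^ 2 := mul_le_mul_of_nonneg_left hsq hT0.le
    _ = T * ((F.L : ℝ) ^ 2 * (1 + Bq * r₀)) ^ 2 * (κ * ε (K - n)) ^ 2 := by ring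

end Summit.QuantumFields.YangMills.BalabanUVNodes.N07HA1LamFreeB

end
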